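import Mathlib.Algebra.Group.Subgroup.Finite
import Mathlib.GroupTheory.Subgroup.Simple
import Mathlib.Data.Fintype.Basic
import Literature.GroupTheory.SpecificGroups.NormalSubgroupsPiSimple
import HarnessLib

/-!
# Helper `helper_hallLemma` of line `prym-layer-stable-rank` for crux
`CongruenceShadows.ShadowsStandard` (item stmt-SmoothPoincare4-14593, route route-SmoothPoincare4-CongruenceShadows)

**Hall's lemma** (P. Hall 1936; the `n`-factor Goursat / Ribet lemma, cf. Dunfield–Thurston,
*Finite covers of random 3-manifolds*, Lemma 3.7): let `T i` (`i ∈ ι`, `ι` finite) be non-abelian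
simple groups and `H ≤ Π i, T i` a subgroup whose projection to every PAIR of distinct factors
`T i × T j` is onto and whose projection to every single factor is onto (the latter only matters
when `ι` has one element). Then `H` is the whole product.

Proof (induction on a finset `s` of coordinates, inside the fixed ambient product). We show
`P s : ∀ x, ∃ h ∈ H, ∀ i ∈ s, h i = x i` ("`H` projects onto the sub-product over `s`").
`P ∅` is trivial. For the step `P s → P (insert a s)` (`a ∉ s`) consider
`K = {g | ∃ h ∈ H, h|ₛ = g|ₛ ∧ h a = 1}`, the pull-back to the ambient product of the kernel of
"`h|ₛ ↦ h a`". By `P s` (conjugate by a preimage) `K` is NORMAL in `Π i, T i`, hence, by the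
classification of normal subgroups of a finite product of non-abelian simple groups
(`Literature.GroupTheory.SpecificGroups.eq_pi_compl_bot_of_normal`), `K` is the sub-product over the
set `J` of factors it contains. Every `i ∉ s` lies in `J` trivially; and `i ∈ s` lies in `J` too:
otherwise every element of `K` vanishes at `i`, but PAIR surjectivity at `(i, a)` produces `h ∈ H`
with `h a = 1` (so `h ∈ K`) and `h i = t` for any `t ≠ 1` in the non-trivial group `T i`. So
`K = ⊤`, i.e. any prescribed values on `s` are attained by some `h ∈ H` with `h a = 1`;
multiplying by a preimage of `x a` under the single projection at `a` gives `P (insert a s)`.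
Finally `P univ` says `H = ⊤`. (The empty and one-element index types need no separate treatment.)

The file declares theorems only.
-/

-- the summit/problem convention `Summit.SmoothPoincare4.SmoothPoincare4.…` repeats a namespace segment
set_option linter.dupNamespace false

noncomputable section

namespace Summit.SmoothPoincare4.SmoothPoincare4.Theorems.ShadowsStandard.PrymLayerStableRank

open Literature.GroupTheory.SpecificGroups

/-- The induction step of Hall's lemma, isolated: if `H ≤ Π i, T i` (all `T i` non-abelian
simple, `ι` finite) projects onto every single factor and onto every pair of distinct factors, and
every `x` is matched on the finset `s` by some element of `H`, then every `x` is matched on `s` by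
some element of `H` whose `a`-coordinate is `1`, for any `a ∉ s`. [folklore] -/
theorem exists_mem_eq_on_and_eq_one {ι : Type*} [Finite ι] [DecidableEq ι] {T : ι → Type*}
    [∀ i, Group (T i)] [∀ i, IsSimpleGroup (T i)] (hT : ∀ i, ¬ IsMulCommutative (T i))
    {H : Subgroup ((i : ι) → T i)}
    (hpair : ∀ i j : ι, i ≠ j → ∀ (x : T i) (y : T j),
      ∃ h : (i : ι) → T i, h ∈ H ∧ h i = x ∧ h j = y)
    {s : Finset ι} {a : ι} (ha : a ∉ s)
    (ih : ∀ x : (i : ι) → T i, ∃ h : (i : ι) → T i, h ∈ H ∧ ∀ i ∈ s, h i = x i)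
    (x : (i : ι) → T i) :
    ∃ h : (i : ι) → T i, h ∈ H ∧ (∀ i ∈ s, h i = x i) ∧ h a = 1 := by
  -- the subgroup `K = {g | ∃ h ∈ H, h|ₛ = g|ₛ ∧ h a = 1}`
  obtain ⟨K, hK⟩ : ∃ K : Subgroup ((i : ι) → T i), ∀ g : (i : ι) → T i,
      g ∈ K ↔ ∃ h : (i : ι) → T i, h ∈ H ∧ (∀ i ∈ s, h i = g i) ∧ h a = 1 := by
    refine ⟨{ carrier := {g | ∃ h : (i : ι) → T i, h ∈ H ∧ (∀ i ∈ s, h i = g i) ∧ h a = 1}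
              mul_mem' := ?_
              one_mem' := ⟨1, H.one_mem, fun i _ => rfl, rfl⟩
              inv_mem' := ?_ }, fun g => Iff.rfl⟩
    · rintro g g' ⟨h, hH, hs, hha⟩ ⟨h', h'H, hs', hha'⟩
      refine ⟨h * h', H.mul_mem hH h'H, fun i hi => ?_, ?_⟩
      · rw [Pi.mul_apply, Pi.mul_apply, hs i hi, hs' i hi]
      · rw [Pi.mul_apply, hha, hha', mul_one]
    · rintro g ⟨h, hH, hs, hha⟩
      refine ⟨h⁻¹, H.inv_mem hH, fun i hi => ?_, ?_⟩
      · rw [Pi.inv_apply, Pi.inv_apply, hs i hi]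
      · rw [Pi.inv_apply, hha, inv_one]
  -- `K` is normal: conjugate the witness by a preimage (under `P s`) of the conjugating element
  haveI : K.Normal := by
    refine ⟨fun g hg k => ?_⟩
    obtain ⟨h, hH, hs, hha⟩ := (hK g).mp hg
    obtain ⟨k', k'H, hk'⟩ := ih k
    refine (hK _).mpr ⟨k' * h * k'⁻¹, H.mul_mem (H.mul_mem k'H hH) (H.inv_mem k'H),
      fun i hi => ?_, ?_⟩
    · simp only [Pi.mul_apply, Pi.inv_apply, hs i hi, hk' i hi]
    · simp only [Pi.mul_apply, Pi.inv_apply, hha, mul_one, mul_inv_cancel]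
  -- hence a sub-product over the set of factors it contains
  have hKeq := eq_pi_compl_bot_of_normal hT K
  -- every factor is contained in `K`
  have hfac : ∀ i, (MonoidHom.mulSingle T i).range ≤ K := by
    intro i
    by_cases his : i ∈ s
    · by_contra hcon
      -- every element of `K` vanishes at `i`
      have hvan : ∀ g ∈ K, g i = 1 := by
        intro g hg
        rw [hKeq] at hg
        exact Subgroup.mem_bot.mp ((Subgroup.mem_pi _).mp hg i hcon)
      -- but pair surjectivity at `(i, a)` gives an element of `K` not vanishing at `i`
      have hia : i ≠ a := fun h => ha (h ▸ his)
      obtain ⟨t, ht⟩ := exists_ne (1 : T i)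
      obtain ⟨h, hH, hi, hha⟩ := hpair i a hia t 1
      exact ht (hi ▸ hvan h ((hK h).mpr ⟨h, hH, fun j _ => rfl, hha⟩))
    · rintro _ ⟨t, rfl⟩
      refine (hK _).mpr ⟨1, H.one_mem, fun j hj => ?_, rfl⟩
      have hji : j ≠ i := fun h => his (h ▸ hj)
      rw [MonoidHom.mulSingle_apply, Pi.mulSingle_eq_of_ne hji, Pi.one_apply]
  -- so `K = ⊤`
  have hKtop : x ∈ K := by
    rw [hKeq]
    exact (Subgroup.mem_pi _).mpr fun i hi => absurd (hfac i) hi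
  exact (hK x).mp hKtop

/-- **REGISTERED HELPER `helper_hallLemma` (Hall's lemma, P. Hall 1936; `n`-factor Goursat /
Ribet lemma, cf. Dunfield–Thurston 2006, Lemma 3.7)**: a subgroup of a finite product of
non-abelian simple groups which projects onto every pair of distinct factors (and onto every single
factor) is the whole product. [folklore] -/
theorem helper_hallLemma :
    ∀ (ι : Type) [Fintype ι] [DecidableEq ι] (T : ι → Type) [∀ i, Group (T i)]
      [∀ i, IsSimpleGroup (T i)], (∀ i, ¬ IsMulCommutative (T i)) →
      ∀ H : Subgroup ((i : ι) → T i),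
        (∀ i j : ι, i ≠ j → ∀ (x : T i) (y : T j),
          ∃ h : (i : ι) → T i, h ∈ H ∧ h i = x ∧ h j = y) →
        (∀ (i : ι) (x : T i), ∃ h : (i : ι) → T i, h ∈ H ∧ h i = x) →
        H = ⊤ := by
  intro ι _ _ T _ _ hT H hpair hsingle
  -- `P s`: `H` projects onto the sub-product over `s`, by induction on the finset `s`
  have key : ∀ (s : Finset ι) (x : (i : ι) → T i),
      ∃ h : (i : ι) → T i, h ∈ H ∧ ∀ i ∈ s, h i = x i := by
    intro s
    induction s using Finset.induction_on with
    | empty => exact fun _ => ⟨1, H.one_mem, fun i hi => absurd hi (Finset.notMem_empty i)⟩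
    | insert a s ha ih =>
      intro x
      -- a preimage of `x a` at the single coordinate `a` ...
      obtain ⟨h₁, h₁H, h₁a⟩ := hsingle a (x a)
      -- ... corrected on `s` by an element with trivial `a`-coordinate
      obtain ⟨h₂, h₂H, h₂s, h₂a⟩ := exists_mem_eq_on_and_eq_one hT hpair ha ih (h₁⁻¹ * x)
      refine ⟨h₁ * h₂, H.mul_mem h₁H h₂H, fun i hi => ?_⟩
      rcases Finset.mem_insert.mp hi with rfl | hi
      · rw [Pi.mul_apply, h₂a, mul_one, h₁a]
      · rw [Pi.mul_apply, h₂s i hi, Pi.mul_apply, Pi.inv_apply, mul_inv_cancel_left]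
  refine (Subgroup.eq_top_iff' H).mpr fun x => ?_
  obtain ⟨h, hH, hx⟩ := key Finset.univ x
  obtain rfl : h = x := funext fun i => hx i (Finset.mem_univ i)
  exact hH

end Summit.SmoothPoincare4.SmoothPoincare4.Theorems.ShadowsStandard.PrymLayerStableRank

end
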